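/-
COR-CM (cell pub-hodgecm2) — ¬hJ RUSH, ROW P-HEAD, CORE FILE 1∕2 (pen nothj-p4 = prover-pub-hodgecm2-nothj-p4-g0-0), 2026-08-24.
A component-Albanese record `J₁` for the TWISTED App.-C datum at instance `ι₁` (the hypothesis `hJ` of the hazard certificates P3–P8)
is CONTRADICTORY given ONLY Hodge-blind inputs: MULTIPLICITY ONE of the tower `H = colim_K H¹(X_K(ℂ); ℂ)` as a `ℂ[U(V)(𝔸_f)]`-module
(semisimple, isomorphic simple submodules coincide — the content of the END-ELECT's [Prop 4.13]-shaped decomposition row with the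
[Def 4.11] adjectives and [Lem D.1 (3)] separation) and ONE non-vanishing `(P-N) Ω(ν) = Hom_E(A_∞, A_ν)_ℚ ≠ 0`.  Mechanism: the TWO
(c)(d) sockets of record over the SAME datum — ✔ `MuKeyHazard.socket_conjAdm_of_componentAlbanese_iota1` (the HYPOTHESIS `J₁` at
instance `ι₁`, conjugate key ⇒ (0,1)-classes) and ✔ `AdapterMuConjByValue.adapter_socket_sharedTail` (the tree's `componentAlbanesePinTotal`
at instance `ῑ₁`, live key ⇒ (1,0)-classes) — give two injective `ℂ[U(V)(𝔸_f)]`-linear maps `ℂ ⊗_{M_ν} Ω(ν) → H`; multiplicity one makes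
them agree on a non-zero submodule (✔ nothj-p6's engine `NotHJ.exists_ne_bot_map_eq_of_multiplicityFree`, `D2Bridge/NotHJTwoSocket.lean`), whose vectors then restrict at deep levels into `H^{1,0} ∩ H^{0,1} = 0`, and tower
separation (✔ `submodule_tower_eq_bot_of_res_eq_zero`) kills it.  THEOREMS ONLY; no `sorry`; no purity row, no block, no `hLiuC`, no
conjugation `κ`.  FRAMING: HC_CM is NOT proved; nothing here asserts hJ or ¬hJ; `J₁` is a HYPOTHESIS, NOT claimed to exist.
-/
import Summits.HodgeConjecture.CorCM.D2Bridge.OrientationT2MuConjTowerAdapterIota1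
import Summits.HodgeConjecture.CorCM.D2Bridge.AdapterMuConjByValue
import Summits.HodgeConjecture.CorCM.D2Bridge.OrientationT2ConjAdm
import Summits.HodgeConjecture.CorCM.D2Bridge.NotHJTwoSocket
import HarnessLib

set_option autoImplicit false

noncomputable section

open scoped TensorProduct DirectSum

namespace Summit.HodgeConjecture.CorCM.D2Bridge.NotHJ

open NumberField
open HodgeCM HodgeCM.Model HodgeCM.Model.TowerCarrier HodgeCM.Model.TowerLevel
open HodgeCM.Literature.Theta HodgeCM.Literature.Theta.LiuAlbaneseModuleDatum
open HodgeCM.Literature.Theta.LiuAlbaneseModuleDatum.D2Bridge (HcmPieces hcm_of_pieces)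
open Literature.AlgebraicGeometry.Motives (CMType)
open Literature.AlgebraicGeometry.HodgeTheory Literature.NumberTheory.Automorphic.PicardCM
open Literature.AlgebraicGeometry.ShimuraVarieties.UnitaryCanonicalModel
open Literature.NumberTheory.Automorphic
open Literature.NumberTheory.Automorphic.Liu2021 Literature.NumberTheory.Automorphic.Liu2021.AppendixC
open Literature.NumberTheory.Automorphic.Liu2021.AppendixC.RestOne
open Literature.NumberTheory.Transcendental (Arapura2012_Cor_15_4_6)
open Literature.RepresentationTheory
open Summit.HodgeConjecture.CorCM.HComp

universe u v w

/-! ## §1 (generic, rows-free) The (4.3)-image of a level generator restricts into the piece's generator class -/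

/-- For ONE `HcmPieces` package at `(D, M, jH, K)`: the class `jH (J (1 ⊗ res_K φ))` of a level-`K` generator `φ ∈ Hom_E(A_K, A_μ)_ℚ`
restricts into any subspace `P ⊇ cmCl` (✔ `hcm_of_pieces` + `Map43RationalData.J_tmul`). [cite: Liu2021, proof of Thm. 4.18, (4.3) (FJcycle.tex l. 2247–2253)] -/
theorem res_jH_J_tmul_mem
    {F E : Type} [Field F] [NumberField F] [IsTotallyReal F] [Field E] [NumberField E] [Algebra F E]
    [IsTotallyComplex E] [Algebra.IsQuadraticExtension F E]
    {D : Thm418Data F E} {M : D.Map43RationalData}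
    {H : Type u} [AddCommGroup H] [Module ℂ H] {jH : M.HB →ₗ[ℂ] H}
    {KK : Subgroup D.G} {W : Type w} [AddCommGroup W] [Module ℂ W] {res : H →ₗ[ℂ] W} {cmCl : Set W}
    (S : HcmPieces.{u, v, w} D M H jH KK W res cmCl) (P : Submodule ℂ W) (hP : cmCl ⊆ P) (φ : D.HomK KK M.Dμ) :
    res (jH (M.toMap43Data.J ((1 : ℂ) ⊗ₜ[fieldOfValues E D.μ] D.res KK M.Dμ φ))) ∈ P := by
  rw [Thm418Data.Map43RationalData.J_tmul, one_smul]
  exact hP (hcm_of_pieces S φ)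

/-- `H¹_{B,τ'}(A_μ; ℚ)` of a rational (4.3)-record is finite over `ℚ`: an `M_μ`-line (`rank_L`) over the number field `M_μ`
(✔ `Thm418Data.numberField_fieldOfValues`) — the standing hypothesis of ✔ `Map43RationalData.injective_J`. [cite: Liu2021, §4.1 (FJcycle.tex l. 1928) and l. 650] -/
theorem finite_rat_L
    {F E : Type} [Field F] [NumberField F] [IsTotallyReal F] [Field E] [NumberField E] [Algebra F E]
    [IsTotallyComplex E] [Algebra.IsQuadraticExtension F E]
    {D : Thm418Data F E} (M : D.Map43RationalData) : Module.Finite ℚ M.L := by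
  haveI := D.numberField_fieldOfValues
  haveI : Module.Finite (fieldOfValues E D.μ) M.L := Module.finite_of_finrank_eq_succ M.rank_L
  exact Module.Finite.trans (fieldOfValues E D.μ) M.L

/-! ## §2 (generic over the tower) Separation with a per-vector threshold -/

section Separation

variable {L : HodgeCM.CMField} {ι₁ : L →+* ℂ} {V : HodgeCM.HermSpace3 L ι₁}

/-- **Separation, per-vector threshold.**  A `U(V)(𝔸_f)`-stable `ℂ`-subspace `N` of the tower `H` each of whose vectors restricts to `0`
on the identity component at EVERY sufficiently deep level of the tower (threshold depending on the vector) is `⊥`: read a level-`Γ`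
presentation at `Γ ⊓ Γ₁` (✔ `res_ofLevel_of_le`), peel the injective level-covering pull-back
(✔ `LevelPullInjective.pull_baseChange_levelCover_injective`), and apply ✔ `submodule_tower_eq_bot_of_res_eq_zero`. [folklore] -/
theorem submodule_tower_eq_bot_of_deep_res_eq_zero (hHD : exists_isReal_hodgeModel) (hI : hodgePQ_independent_of_hodgeModel)
    (hU : BallQuotientUniformisedDatum) (h₃ : CMAbelianVarietyRealised) (hA : Arapura2012_Cor_15_4_6)
    (N : Submodule ℂ (Tower hHD hI hU h₃ hA V))
    (hN : ∀ (g : ↥V.adelicFin) (x : Tower hHD hI hU h₃ hA V), x ∈ N → act hHD hI hU h₃ hA g x ∈ N)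
    (h0 : ∀ x ∈ N, ∃ (Γ₁ : HodgeCM.Level V), Γ₁.BelowConjThree ∧ ∀ (Γ : HodgeCM.Level V) (hΓ : Γ.BelowConjThree), Γ ≤ Γ₁ →
      TowerCarrier.res hHD hI hU h₃ hA Γ hΓ x = 0) :
    N = ⊥ := by
  refine submodule_tower_eq_bot_of_res_eq_zero hHD hI hU h₃ hA N hN (HodgeCM.Level.three V) ?_
  intro Γ hΓ _ x hx hlev
  obtain ⟨Γ₁, -, hdeep⟩ := h0 x hx
  obtain ⟨c, rfl⟩ := hlev
  have hle : Γ ⊓ Γ₁ ≤ Γ := inf_le_left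
  have hΓ' : (Γ ⊓ Γ₁).BelowConjThree := hΓ.of_le hle
  have h01 := hdeep (Γ ⊓ Γ₁) hΓ' inf_le_right
  rw [res_ofLevel_of_le hHD hI hU h₃ hA hle hΓ hΓ' c] at h01
  -- `h01 : π^*_ℂ (res Γ (ofLevel c)) = 0` with `π` the level covering `P_{Γ ⊓ Γ₁} → P_Γ`, injective on cohomology
  have key : (BettiUniverse.pull (levelCover hU h₃ hHD hA Γ (Γ ⊓ Γ₁) (HodgeCM.Level.Γ_mono hle)) 1).baseChange ℂ
      (TowerCarrier.res hHD hI hU h₃ hA Γ hΓ (ofLevel hHD hI hU h₃ hA Γ hΓ c)) = 0 := h01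
  exact LevelPullInjective.pull_baseChange_levelCover_injective hHD hU h₃ hA (HodgeCM.Level.Γ_mono hle) 1
    (key.trans (map_zero _).symm)

end Separation

/-! ## §4 (pin-generic) Every element of `Ω(ν) = Hom_E(A_∞, A_ν)_ℚ` of the one-object rest comes from a deep level -/

section Exhaust

variable {L : HodgeCM.CMField} {ι₁ : (L : Type) →+* ℂ}

set_option synthInstance.maxHeartbeats 400000 in
set_option maxHeartbeats 3200000 in
/-- **`Ω(ν)` is exhausted by the deep levels of the tower.**  At the one-object rest `U.rest (restTailOne (AlgHom.id ℚ L) ι₁ hν hwν Carν rhoΩ)`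
over the App.-C datum of record, `Ω(ν) = colim_K ℚ ⊗_ℤ Hom_E(A_K, A_ν)` (`ΩOne` = `Module.DirectLimit`, `RestOne.lean` §4–§5), so every `f ∈ Ω(ν)`
is `res_Γ φ` for SOME `φ` at EVERY tower level `Γ` below some `K ≤ capThree K₀` (`Module.DirectLimit.exists_of`, then pull-back along
`Alb_{u}`, `resOne_pull`). [cite: Liu2021, §4.2 FJcycle.tex l. 2070–2072; Def. 4.16, Rem. 4.17] -/
theorem exists_level_forall_res_eq [IsGalois ℚ (L : Type)] (V : HodgeCM.HermSpace3 L ι₁) (h : exists_recordSystem) (Φ : CMType (pkgF L))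
    (iso : ∀ (F : Summit.HodgeConjecture.CorCM.CMField) (ι : F →+* ℂ) (_ : Summit.HodgeConjecture.CorCM.HermSpace3 F ι)
      (_ : CMType F), ℕ → Prop)
    (U : UniformOmega (Model.sec42DataOf h iso (pkgF L) ι₁ (pkgV V) Φ))
    {ν : Literature.NumberTheory.Automorphic.IdeleClassGroup L →ₜ* Circle} (hν : IdeleClassGroup.IsConjugateSymplectic (L : Type) ν)
    (hwν : IdeleClassGroup.HasWeight (L : Type) ν 1) (Carν : Def45.Carriers (L : Type) ν)
    (rhoΩ : Representation (fieldOfValues (L : Type) ν) (Model.sec42DataOf h iso (pkgF L) ι₁ (pkgV V) Φ).G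
      (ΩOne (Model.sec42DataOf h iso (pkgF L) ι₁ (pkgV V) Φ) (AlgHom.id ℚ (L : Type)) ι₁ hν hwν Carν))
    (Dν : ObjOne (AlgHom.id ℚ (L : Type)) ι₁ hν hwν Carν)
    (f : (toThm418Data _ (U.rest (restTailOne (AlgHom.id ℚ (L : Type)) ι₁ hν hwν Carν rhoΩ))).Ω) :
    ∃ K : HodgeCM.Level V, K ≤ HodgeCM.Level.capThree (V := V)
        ((Model.sec42DataOf h iso (pkgF L) ι₁ (pkgV V) Φ).S.K₀.1 : Subgroup ↥V.adelicFin) (Model.sec42DataOf h iso (pkgF L) ι₁ (pkgV V) Φ).S.K₀.2.1 ∧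
      ∀ Γ : HodgeCM.Level V, Γ ≤ K →
        ∃ φ : (toThm418Data _ (U.rest (restTailOne (AlgHom.id ℚ (L : Type)) ι₁ hν hwν Carν rhoΩ))).HomK Γ.K Dν,
          (toThm418Data _ (U.rest (restTailOne (AlgHom.id ℚ (L : Type)) ι₁ hν hwν Carν rhoΩ))).res Γ.K Dν φ = f := by
  classical
  set C := Model.sec42DataOf h iso (pkgF L) ι₁ (pkgV V) Φ with hC
  haveI : Nonempty (Idx C) := ⟨OrderDual.toDual ⟨C.S.K₀, le_rfl⟩⟩
  haveI : IsDirectedOrder (Idx C) :=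
    ⟨fun i j => by
      obtain ⟨K'', hK, hK'⟩ := smallLevel_exists_le_le C (OrderDual.ofDual i) (OrderDual.ofDual j)
      exact ⟨OrderDual.toDual K'', hK, hK'⟩⟩
  -- `f Dν ∈ colim_K ℚ ⊗ Hom(A_K, A_ν)` comes from some small level `Ksm`
  obtain ⟨i, t, hit⟩ := Module.DirectLimit.exists_of (f Dν)
  set Ksm : C5.SmallLevel C.S.K₀ := OrderDual.ofDual i with hKsm
  refine ⟨HodgeCM.Level.capThree (V := V) (C.S.K₀.1 : Subgroup ↥V.adelicFin) C.S.K₀.2.1 ⊓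
      HodgeCM.Level.capThree (V := V) (Ksm.1.1 : Subgroup ↥V.adelicFin) Ksm.1.2.1, inf_le_left, fun Γ hΓ => ?_⟩
  -- the level `Γ` is a sufficiently small open compact below `Ksm`
  have hΓK₀ : Γ.K ≤ (C.S.K₀.1 : Subgroup ↥V.adelicFin) :=
    (HodgeCM.Level.le_def.1 (hΓ.trans inf_le_left)).trans (HodgeCM.Level.capThree_K_le _ _)
  have hΓsm : Γ.K ≤ (Ksm.1.1 : Subgroup ↥V.adelicFin) :=
    (HodgeCM.Level.le_def.1 (hΓ.trans inf_le_right)).trans (HodgeCM.Level.capThree_K_le _ _)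
  have hoc : IsOpenCompact Γ.K := ⟨Γ.isOpen_K, Γ.isCompact_K⟩
  have hcoe : ((C.levelOf Γ.K).1 : Subgroup C.G) = Γ.K := Sec42Data.coe_levelOf C hoc hΓK₀
  have hle : C.levelOf Γ.K ≤ Ksm := by
    change ((C.levelOf Γ.K).1 : Subgroup C.G) ≤ (Ksm.1.1 : Subgroup ↥V.adelicFin)
    rw [hcoe]; exact hΓsm
  refine ⟨Sec42Data.HomQ.pull C (CategoryTheory.homOfLE hle) (AμOne (AlgHom.id ℚ (L : Type)) ι₁ hν hwν Carν Dν) t, ?_⟩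
  -- `res_Γ (u^* t) = res_{Ksm} t = f`
  show resOne C (AlgHom.id ℚ (L : Type)) ι₁ hν hwν Carν (C.levelOf Γ.K) Dν
      (Sec42Data.HomQ.pull C (CategoryTheory.homOfLE hle) (AμOne (AlgHom.id ℚ (L : Type)) ι₁ hν hwν Carν Dν) t) = f
  rw [resOne_pull]
  funext D'
  obtain rfl : D' = Dν := Subsingleton.elim _ _
  exact hit

end Exhaust

/-! ## §5 THE TWO-SOCKET CORE (generic over the App.-C datum `C` and the rest `R`) -/

section Core

variable {L : HodgeCM.CMField} {ι₁ : (L : Type) →+* ℂ}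

set_option synthInstance.maxHeartbeats 400000 in
set_option maxHeartbeats 6400000 in
/-- **THE TWO-SOCKET CORE.**  Over ANY App.-C datum `C` of `(L, ι₁, V, Φ)` and ANY rest `R` (`D := toThm418Data C R`): two rational
(4.3)-records `M, M̄` of `D` read injectively and equivariantly into the tower `H` (`jH, jH̄`), with Albanese-on-pieces packages below a tower
level `K⋆` whose generator classes are of type `(0,1)` for `M` and `(1,0)` for `M̄` (`h01 ∕ h10`), every `f ∈ Ω(μ)` coming from all deep levels
for both objects (`hexh`); DISPLAYED: the tower is a semisimple `ℂ[U(V)(𝔸_f)]`-module whose isomorphic simple submodules coincide (`hss ∕ hmf`,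
multiplicity one) and `Ω(μ) ≠ 0`.  Then `False`: on a non-zero submodule `S ≤ ℂ ⊗_{M_μ} Ω(μ)` the two (4.3) maps have the same image
(multiplicity one), so its vectors restrict at deep levels into `H^{1,0} ∩ H^{0,1} = 0`, and tower separation kills it.
[cite: Liu2021, proof of Thm. 4.18, (4.3) (FJcycle.tex l. 2247–2253); Prop. 4.13; Lem. D.1 (3)] [cite: VoisinHodgeI2002, §6.1.3 Cor. 6.14] -/
theorem false_of_twoSockets
    {hHD : exists_isReal_hodgeModel} {hI : hodgePQ_independent_of_hodgeModel}
    {h₁ : BallQuotientUniformised} {h₃ : CMAbelianVarietyRealised} {hA : Arapura2012_Cor_15_4_6}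
    (V : HodgeCM.HermSpace3 L ι₁) (h : exists_recordSystem) (Φ : CMType (L : Type)) {isotropicAt : ℕ → Prop}
    (C : Sec42Data (Model.honestP5Of h ⟨L.K⟩ ι₁ ⟨V.Hm, V.isHermitian, V.signature_ι₁, V.posDef_of_ne⟩ Φ) isotropicAt)
    (R : Thm418Rest C) (M Mb : (toThm418Data C R).Map43RationalData)
    (jH : M.HB →ₗ[ℂ] Tower hHD hI (ballQuotientUniformisedDatum_of h₁) h₃ hA V)
    (jHb : Mb.HB →ₗ[ℂ] Tower hHD hI (ballQuotientUniformisedDatum_of h₁) h₃ hA V)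
    (hjHinj : Function.Injective jH) (hjHbinj : Function.Injective jHb)
    (hjH : ∀ (g : ↥V.adelicFin) (x : M.HB), jH (M.ρB g x) = MonoidAlgebra.of ℂ ↥V.adelicFin g • jH x)
    (hjHb : ∀ (g : ↥V.adelicFin) (x : Mb.HB), jHb (Mb.ρB g x) = MonoidAlgebra.of ℂ ↥V.adelicFin g • jHb x)
    (Kstar : HodgeCM.Level V) (hKstar : Kstar.BelowConjThree)
    (cm01 cm10 : ∀ K : HodgeCM.Level V, Set ((picardCMUniverse hHD hI h₁ h₃).CohC ((picardCMUniverse hHD hI h₁ h₃).pms L ι₁ V K) 1))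
    (hpieces : ∀ K : HodgeCM.Level V, K ≤ Kstar → Nonempty (HcmPieces.{0, 1, 0} (toThm418Data C R) M
      (Tower hHD hI (ballQuotientUniformisedDatum_of h₁) h₃ hA V) jH K.K
      ((picardCMUniverse hHD hI h₁ h₃).CohC ((picardCMUniverse hHD hI h₁ h₃).pms L ι₁ V K) 1)
      (resTotal hHD hI (ballQuotientUniformisedDatum_of h₁) h₃ hA K) (cm01 K)))
    (hpiecesb : ∀ K : HodgeCM.Level V, K ≤ Kstar → Nonempty (HcmPieces.{0, 1, 0} (toThm418Data C R) Mb
      (Tower hHD hI (ballQuotientUniformisedDatum_of h₁) h₃ hA V) jHb K.K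
      ((picardCMUniverse hHD hI h₁ h₃).CohC ((picardCMUniverse hHD hI h₁ h₃).pms L ι₁ V K) 1)
      (resTotal hHD hI (ballQuotientUniformisedDatum_of h₁) h₃ hA K) (cm10 K)))
    (h01 : ∀ K : HodgeCM.Level V, cm01 K ⊆ ((picardCMUniverse hHD hI h₁ h₃).hodge ((picardCMUniverse hHD hI h₁ h₃).pms L ι₁ V K) 1).piece 0 1)
    (h10 : ∀ K : HodgeCM.Level V, cm10 K ⊆ ((picardCMUniverse hHD hI h₁ h₃).hodge ((picardCMUniverse hHD hI h₁ h₃).pms L ι₁ V K) 1).piece 1 0)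
    (hexh : ∀ f : (toThm418Data C R).Ω, ∃ K : HodgeCM.Level V, K ≤ Kstar ∧ ∀ Γ : HodgeCM.Level V, Γ ≤ K →
      (∃ φ : (toThm418Data C R).HomK Γ.K M.Dμ, (toThm418Data C R).res Γ.K M.Dμ φ = f) ∧
      (∃ φ' : (toThm418Data C R).HomK Γ.K Mb.Dμ, (toThm418Data C R).res Γ.K Mb.Dμ φ' = f))
    -- DISPLAYED: multiplicity one of the tower and non-vanishing of `Ω(μ)`
    (hss : IsSemisimpleModule (MonoidAlgebra ℂ ↥V.adelicFin) (Tower hHD hI (ballQuotientUniformisedDatum_of h₁) h₃ hA V))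
    (hmf : ∀ S S' : Submodule (MonoidAlgebra ℂ ↥V.adelicFin) (Tower hHD hI (ballQuotientUniformisedDatum_of h₁) h₃ hA V),
      IsAtom S → IsAtom S' → Nonempty (S ≃ₗ[MonoidAlgebra ℂ ↥V.adelicFin] S') → S = S')
    (hPN : Nontrivial (toThm418Data C R).Ω) : False := by
  classical
  let hU : BallQuotientUniformisedDatum := ballQuotientUniformisedDatum_of h₁
  haveI := finite_rat_L M
  haveI := finite_rat_L Mb
  haveI := hPN
  -- `W := ℂ ⊗_{M_μ} Ω(μ)`, non-trivial (`ℂ` faithfully flat over the field `M_μ`), with the base-changed Hecke action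
  haveI hW : Nontrivial (ℂ ⊗[fieldOfValues (L : Type) (toThm418Data C R).μ] (toThm418Data C R).Ω) := inferInstance
  let ρW : Representation ℂ ↥V.adelicFin (ℂ ⊗[fieldOfValues (L : Type) (toThm418Data C R).μ] (toThm418Data C R).Ω) :=
    { toFun := fun g => ((toThm418Data C R).rhoΩ g).baseChange ℂ
      map_one' := by
        have h1 : (toThm418Data C R).rhoΩ (1 : ↥V.adelicFin) = 1 := map_one _
        simp only [h1, LinearMap.baseChange_one]
      map_mul' := fun a b => by
        have hm : (toThm418Data C R).rhoΩ (a * b) = (toThm418Data C R).rhoΩ a * (toThm418Data C R).rhoΩ b := map_mul _ a b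
        simp only [hm, LinearMap.baseChange_mul] }
  -- the two (4.3) maps into the tower: equivariant, injective
  let B : ℂ ⊗[fieldOfValues (L : Type) (toThm418Data C R).μ] (toThm418Data C R).Ω →ₗ[ℂ] Tower hHD hI hU h₃ hA V :=
    jH ∘ₗ M.toMap43Data.J
  let A : ℂ ⊗[fieldOfValues (L : Type) (toThm418Data C R).μ] (toThm418Data C R).Ω →ₗ[ℂ] Tower hHD hI hU h₃ hA V :=
    jHb ∘ₗ Mb.toMap43Data.J
  have hBeq : ∀ (g : ↥V.adelicFin) w, B (ρW g w) = act hHD hI hU h₃ hA g (B w) := fun g w => by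
    show jH (M.toMap43Data.J (((toThm418Data C R).rhoΩ g).baseChange ℂ w)) = act hHD hI hU h₃ hA g (jH (M.toMap43Data.J w))
    rw [M.hJ g w, ← of_smul_eq_act]
    exact hjH g _
  have hAeq : ∀ (g : ↥V.adelicFin) w, A (ρW g w) = act hHD hI hU h₃ hA g (A w) := fun g w => by
    show jHb (Mb.toMap43Data.J (((toThm418Data C R).rhoΩ g).baseChange ℂ w)) = act hHD hI hU h₃ hA g (jHb (Mb.toMap43Data.J w))
    rw [Mb.hJ g w, ← of_smul_eq_act]
    exact hjHb g _
  have hBinj : Function.Injective B := hjHinj.comp M.injective_J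
  have hAinj : Function.Injective A := hjHbinj.comp Mb.injective_J
  -- `W` as a `ℂ[U(V)(𝔸_f)]`-module, and the `ℂ[U(V)(𝔸_f)]`-linear forms of `B`, `A`
  letI instW : Module (MonoidAlgebra ℂ ↥V.adelicFin) (ℂ ⊗[fieldOfValues (L : Type) (toThm418Data C R).μ] (toThm418Data C R).Ω) :=
    Module.compHom _ ρW.asAlgebraHom.toRingHom
  have smulW : ∀ (r : MonoidAlgebra ℂ ↥V.adelicFin) (w : ℂ ⊗[fieldOfValues (L : Type) (toThm418Data C R).μ] (toThm418Data C R).Ω),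
      r • w = ρW.asAlgebraHom r w := fun _ _ => rfl
  have linB : ∀ (r : MonoidAlgebra ℂ ↥V.adelicFin) w, B (r • w) = r • B w := by
    intro r
    refine MonoidAlgebra.induction_on (p := fun r => ∀ w, B (r • w) = r • B w) r ?_ ?_ ?_
    · intro g w
      rw [smulW, Representation.asAlgebraHom_of, of_smul_eq_act]
      exact hBeq g w
    · intro f g hf hg w
      rw [add_smul, map_add, hf, hg, add_smul]
    · intro a f hf w
      have e1 : (a • f) • w = a • (f • w) := by
        rw [smulW, smulW, map_smul, LinearMap.smul_apply]
      rw [e1, map_smul, hf, smul_assoc]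
  have linA : ∀ (r : MonoidAlgebra ℂ ↥V.adelicFin) w, A (r • w) = r • A w := by
    intro r
    refine MonoidAlgebra.induction_on (p := fun r => ∀ w, A (r • w) = r • A w) r ?_ ?_ ?_
    · intro g w
      rw [smulW, Representation.asAlgebraHom_of, of_smul_eq_act]
      exact hAeq g w
    · intro f g hf hg w
      rw [add_smul, map_add, hf, hg, add_smul]
    · intro a f hf w
      have e1 : (a • f) • w = a • (f • w) := by
        rw [smulW, smulW, map_smul, LinearMap.smul_apply]
      rw [e1, map_smul, hf, smul_assoc]
  let BR : ℂ ⊗[fieldOfValues (L : Type) (toThm418Data C R).μ] (toThm418Data C R).Ω →ₗ[MonoidAlgebra ℂ ↥V.adelicFin]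
      Tower hHD hI hU h₃ hA V :=
    { toFun := B, map_add' := B.map_add, map_smul' := linB }
  let AR : ℂ ⊗[fieldOfValues (L : Type) (toThm418Data C R).μ] (toThm418Data C R).Ω →ₗ[MonoidAlgebra ℂ ↥V.adelicFin]
      Tower hHD hI hU h₃ hA V :=
    { toFun := A, map_add' := A.map_add, map_smul' := linA }
  have hBR : ∀ w, BR w = B w := fun _ => rfl
  have hAR : ∀ w, AR w = A w := fun _ => rfl
  have hBRinj : Function.Injective BR := hBinj
  have hARinj : Function.Injective AR := hAinj
  haveI := hss
  -- multiplicity one: `B(S) = A(S)` on a non-zero submodule `S ≤ W`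
  obtain ⟨S, hS, hSS⟩ := exists_ne_bot_map_eq_of_multiplicityFree (R := MonoidAlgebra ℂ ↥V.adelicFin)
    (T' := Tower hHD hI hU h₃ hA V) (W' := ℂ ⊗[fieldOfValues (L : Type) (toThm418Data C R).μ] (toThm418Data C R).Ω)
    (fun S S' hS hS' e => hmf S S' (isSimpleModule_iff_isAtom.1 hS) (isSimpleModule_iff_isAtom.1 hS') e) BR AR hBRinj hARinj
  -- the TYPING of the two (4.3) maps at deep levels: `B` into `H^{0,1}`, `A` into `H^{1,0}`
  have typing : ∀ w : ℂ ⊗[fieldOfValues (L : Type) (toThm418Data C R).μ] (toThm418Data C R).Ω,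
      ∃ Γ₁ : HodgeCM.Level V, Γ₁.BelowConjThree ∧ ∀ (Γ : HodgeCM.Level V) (hΓ : Γ.BelowConjThree), Γ ≤ Γ₁ →
        TowerCarrier.res hHD hI hU h₃ hA Γ hΓ (B w) ∈
            ((picardCMUniverse hHD hI h₁ h₃).hodge ((picardCMUniverse hHD hI h₁ h₃).pms L ι₁ V Γ) 1).piece 0 1 ∧
          TowerCarrier.res hHD hI hU h₃ hA Γ hΓ (A w) ∈
            ((picardCMUniverse hHD hI h₁ h₃).hodge ((picardCMUniverse hHD hI h₁ h₃).pms L ι₁ V Γ) 1).piece 1 0 := by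
    intro w
    induction w using TensorProduct.induction_on with
    | zero =>
      exact ⟨Kstar, hKstar, fun Γ hΓ _ => by simp only [map_zero]; exact ⟨Submodule.zero_mem _, Submodule.zero_mem _⟩⟩
    | add x y hx hy =>
      obtain ⟨Γ₁, hΓ₁, hx⟩ := hx
      obtain ⟨Γ₂, -, hy⟩ := hy
      refine ⟨Γ₁ ⊓ Γ₂, hΓ₁.of_le inf_le_left, fun Γ hΓ hle => ?_⟩
      obtain ⟨hx1, hx2⟩ := hx Γ hΓ (hle.trans inf_le_left)
      obtain ⟨hy1, hy2⟩ := hy Γ hΓ (hle.trans inf_le_right)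
      simp only [map_add]
      exact ⟨Submodule.add_mem _ hx1 hy1, Submodule.add_mem _ hx2 hy2⟩
    | tmul z f =>
      obtain ⟨K, hK, hφ⟩ := hexh f
      refine ⟨K, hKstar.of_le hK, fun Γ hΓ hle => ?_⟩
      obtain ⟨⟨φ, hφf⟩, ⟨φ', hφ'f⟩⟩ := hφ Γ hle
      obtain ⟨SΓ⟩ := hpieces Γ (hle.trans hK)
      obtain ⟨SΓb⟩ := hpiecesb Γ (hle.trans hK)
      have ez : z ⊗ₜ[fieldOfValues (L : Type) (toThm418Data C R).μ] f =
          z • ((1 : ℂ) ⊗ₜ[fieldOfValues (L : Type) (toThm418Data C R).μ] f) := by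
        rw [TensorProduct.smul_tmul', smul_eq_mul, mul_one]
      rw [ez, map_smul, map_smul, map_smul, map_smul]
      refine ⟨Submodule.smul_mem _ _ ?_, Submodule.smul_mem _ _ ?_⟩
      · have key := res_jH_J_tmul_mem SΓ _ (h01 Γ) φ
        rw [hφf, resTotal_of hHD hI hU h₃ hA Γ hΓ] at key
        exact key
      · have key := res_jH_J_tmul_mem SΓb _ (h10 Γ) φ'
        rw [hφ'f, resTotal_of hHD hI hU h₃ hA Γ hΓ] at key
        exact key
  -- `B(S)` is `U(V)(𝔸_f)`-stable and all its vectors restrict to `0` at deep levels ⇒ `B(S) = ⊥`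
  have hN : (S.map BR).restrictScalars ℂ = ⊥ := by
    refine submodule_tower_eq_bot_of_deep_res_eq_zero hHD hI hU h₃ hA _ ?_ ?_
    · intro g y hy
      have hy' : MonoidAlgebra.of ℂ ↥V.adelicFin g • y ∈ S.map BR := (S.map BR).smul_mem _ hy
      rw [of_smul_eq_act] at hy'
      exact hy'
    · intro y hy
      rw [Submodule.restrictScalars_mem, Submodule.mem_map] at hy
      obtain ⟨w, hw, rfl⟩ := hy
      have hy2 : BR w ∈ S.map AR := by rw [← hSS]; exact ⟨w, hw, rfl⟩
      rw [Submodule.mem_map] at hy2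
      obtain ⟨w', -, hw'⟩ := hy2
      obtain ⟨Γ₁, hΓ₁, hT⟩ := typing w
      obtain ⟨Γ₁', -, hT'⟩ := typing w'
      refine ⟨Γ₁ ⊓ Γ₁', hΓ₁.of_le inf_le_left, fun Γ hΓ hle => ?_⟩
      have hb : TowerCarrier.res hHD hI hU h₃ hA Γ hΓ (B w) ∈
          ((picardCMUniverse hHD hI h₁ h₃).hodge ((picardCMUniverse hHD hI h₁ h₃).pms L ι₁ V Γ) 1).piece 0 1 :=
        (hT Γ hΓ (hle.trans inf_le_left)).1
      have ha : TowerCarrier.res hHD hI hU h₃ hA Γ hΓ (B w) ∈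
          ((picardCMUniverse hHD hI h₁ h₃).hodge ((picardCMUniverse hHD hI h₁ h₃).pms L ι₁ V Γ) 1).piece 1 0 := by
        have e : B w = A w' := by rw [← hBR, ← hAR]; exact hw'.symm
        rw [e]; exact (hT' Γ hΓ (hle.trans inf_le_right)).2
      exact (Submodule.disjoint_def.1 (disjoint_hodgePiece_one_zero hHD hI h₁ h₃ Γ)) _ ha hb
  -- hence `S = ⊥`: contradiction
  apply hS
  rw [eq_bot_iff]
  intro x hx
  have hBx : BR x ∈ (S.map BR).restrictScalars ℂ := by
    rw [Submodule.restrictScalars_mem]; exact ⟨x, hx, rfl⟩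
  rw [hN, Submodule.mem_bot] at hBx
  rw [Submodule.mem_bot]
  exact hBRinj (by rw [hBx, map_zero])

end Core

end Summit.HodgeConjecture.CorCM.D2Bridge.NotHJ

end
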